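import Summits.RiemannHypothesis.RiemannHypothesis.Theorems.GroundBartaPolarPerronFrobeniusEvenRealGroundState
import HarnessLib

/-!
# RiemannHypothesis / GroundBarta — crux `PolarPerronFrobenius` (stmt-RiemannHypothesis-18390):
# NEGATIVE knowledge — clause census of the conclusion `GSP a`

Negative-side helper file of the standing disprover (gen 4; `--supports stmt-RiemannHypothesis-18390`; lane
`Theorems/PolarPerronFrobenius/Negative/`), RH-free, Mathlib + landed tree files only, no definitions, no named
facts, no sorry.  Companion of `Cruxes/PolarPerronFrobenius/Disproof.lean`, finding F9.

The crux is `∀ A, ∃ a ≥ A, (EW a → GSP a)` with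
`GSP a = ∃ u, (MemLp u 2 ∧ <uₙ normalised window tests, eventually δ-below every competitor, uₙ → u in L²>) ∧
(a.e. on (-a, a): Im u = 0 ∧ 0 ≤ Re u)`.  Gens 1–3 analysed the HYPOTHESES (height, prime support, the guard
`EW`); this file does the LOAD-BEARING ANALYSIS OF THE CONCLUSION, clause by clause, kernel-checked:

1. `integral_norm_sq_sub_one_eq_zero`, `const_one_passes_all_but_memLp`, `polarPerronFrobenius_trivial_without_memLp`
   — drop the guard `MemLp u 2` and the constant function `u ≡ 1` is a "one-signed ground state" at EVERY window
   `a > 0`: `t ↦ ‖gₙ t − 1‖²` equals `1` off the support of `gₙ`, is not integrable on `ℝ`, and its Bochner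
   integral is the junk value `0`, so `∫‖gₙ − 1‖² → 0` holds for every minimising sequence.  The guard is the only
   thing standing between the crux and this junk (with it, `gₙ − u ∈ L²` and the integral is genuine).
2. `exists_isWeilGroundState_re_eq_zero`, `not_ae_real_of_re_eq_zero`, `polarPerronFrobenius_trivial_without_real`
   — drop the realness clause `Im u = 0` (keeping `MemLp`, the genuine `L²` limit and `0 ≤ Re u`) and the crux is an
   RH-free THEOREM: at every window `a > 0` at which the even sector carries the bottom, `u = i·u₀` (`u₀` the even
   real-valued ground state of B's `exists_even_real_isWeilGroundState`, phase invariance `IsWeilGroundState.const_mul`)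
   is a genuine ground state with `Re u ≡ 0 ≥ 0` — and it violates `Im u = 0` on a set of positive measure of the
   window.  So `0 ≤ Re u` alone carries no sign information; the content of `GSP a` is the conjunction.
3. `polarPerronFrobenius_trivial_without_sign` — drop `0 ≤ Re u` (keeping realness) and the crux is again an RH-free
   theorem (B's even real ground state itself).  Census: of the four clauses of `GSP a` each of `MemLp`, `Im u = 0`,
   `0 ≤ Re u` is individually load-bearing, and what any proof must establish is exactly "a genuine `L²` ground state
   taking values in `[0, ∞)` a.e. on the open window" — the SHAPE statement of F3–F8, nothing softer.

Refuter `refuter-cdisprove-stmt-RiemannHypothesis-18390-g4-0` (cdisprove gen 4).  References: E. Bombieri, Rend. Lincei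
(9) 11 (2000) §4 (Problem 2, Thm 3); prover B's `…EvenRealGroundState`; Literature `WeilGroundState`
(`IsWeilGroundState.const_mul`, `.ae_eq_zero_of_notMem`, `exists_weilMinimizingSeq`).
-/

set_option linter.dupNamespace false

noncomputable section

open MeasureTheory Complex Filter Set
open scoped Real Topology

namespace Summit.RiemannHypothesis.RiemannHypothesis.Theorems.PolarPerronFrobenius.Negative

open Literature.NumberTheory.LFunctions
open Summit.RiemannHypothesis.RiemannHypothesis.Theses.GroundBarta
open Summit.RiemannHypothesis.RiemannHypothesis.Theorems.PolarPerronFrobenius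

/-! ### 1. The guard `MemLp u 2` is load-bearing: without it the constant `1` is a "ground state" -/

/-- **Bochner junk.**  For a test function `g` (smooth, compactly supported) the function `t ↦ ‖g t - 1‖²` equals `1`
off the support of `g`; it is therefore NOT integrable on `ℝ` (its difference from the constant `1` is continuous and
compactly supported, hence integrable, and constants are not integrable for Lebesgue measure), and its Bochner integral
takes the junk value `0`. [folklore] -/
theorem integral_norm_sq_sub_one_eq_zero {g : ℝ → ℂ} (hg : IsWeilTest g) :
    ∫ t, ‖g t - 1‖ ^ 2 = (0 : ℝ) := by
  apply integral_undef
  intro hint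
  have hφ : Continuous fun z : ℂ ↦ ‖z - 1‖ ^ 2 - 1 := by fun_prop
  have hcs : HasCompactSupport fun t ↦ ‖g t - 1‖ ^ 2 - 1 :=
    hg.2.comp_left (g := fun z : ℂ ↦ ‖z - 1‖ ^ 2 - 1) (by simp)
  have hint2 : Integrable fun t ↦ ‖g t - 1‖ ^ 2 - 1 :=
    (hφ.comp hg.1.continuous).integrable_of_hasCompactSupport hcs
  have hconst : Integrable fun _ : ℝ ↦ (1 : ℝ) := by
    have h := hint.sub hint2
    refine h.congr (Eventually.of_forall fun t ↦ ?_)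
    simp only [Pi.sub_apply]
    ring
  have hfin : IsFiniteMeasure (volume : Measure ℝ) :=
    (integrable_const_iff_isFiniteMeasure one_ne_zero).1 hconst
  have hlt := measure_lt_top (volume : Measure ℝ) univ
  simp at hlt

/-- **The constant function `1` passes every clause of the ground-state predicate except `MemLp u 2`**, at every
window `a > 0`: there is an `L²`-normalised sequence of window tests, eventually `δ`-below every normalised window
test (a minimising sequence, `exists_weilMinimizingSeq`), with `∫‖gₙ − 1‖² → 0` — by Bochner junk, every term of
that sequence of integrals being `0` (`integral_norm_sq_sub_one_eq_zero`).  `1 ∉ L²(ℝ)`, and `1` is real and `≥ 0`.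
[folklore] -/
theorem const_one_passes_all_but_memLp {a : ℝ} (ha : 0 < a) :
    ∃ g : ℕ → ℝ → ℂ,
      (∀ n, IsWeilTest (g n) ∧ tsupport (g n) ⊆ Icc (-a) a ∧ ∫ t, ‖g n t‖ ^ 2 = (1 : ℝ)) ∧
      (∀ h : ℝ → ℂ, IsWeilTest h → tsupport h ⊆ Icc (-a) a → ∫ t, ‖h t‖ ^ 2 = (1 : ℝ) →
        ∀ δ : ℝ, 0 < δ → ∀ᶠ n in atTop, (weilQuadratic (g n)).re ≤ (weilQuadratic h).re + δ) ∧
      Tendsto (fun n ↦ ∫ t, ‖g n t - (1 : ℂ)‖ ^ 2) atTop (𝓝 0) := by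
  obtain ⟨g, hg, hQ⟩ := exists_weilMinimizingSeq ha
  refine ⟨g, hg, (forall_eventually_le_iff_tendsto_weilGroundEnergy hg).2 hQ, ?_⟩
  have h0 : (fun n ↦ ∫ t, ‖g n t - (1 : ℂ)‖ ^ 2) = fun _ ↦ (0 : ℝ) :=
    funext fun n ↦ integral_norm_sq_sub_one_eq_zero (hg n).1
  rw [h0]
  exact tendsto_const_nhds

/-- **`PolarPerronFrobenius` with the guard `MemLp u 2` deleted is junk-true** (RH-free, and without using the
even-winning hypothesis): at every window `a ≥ max A 1` the constant `u ≡ 1` witnesses the weakened conclusion.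
Route-inline vocabulary up to the definitional unfoldings `IsWeilTest g = (ContDiff ℝ ∞ g ∧ HasCompactSupport g)` and
`weilQuadratic = Q`. [folklore] -/
theorem polarPerronFrobenius_trivial_without_memLp :
    ∀ A : ℝ, ∃ a : ℝ, A ≤ a ∧
      ((∀ o : ℝ → ℂ, IsWeilTest o → tsupport o ⊆ Icc (-a) a → (∀ t, o (-t) = -o t) →
          ∫ t, ‖o t‖ ^ 2 = (1 : ℝ) → ∀ δ : ℝ, 0 < δ → ∃ w : ℝ → ℂ, IsWeilTest w ∧
            tsupport w ⊆ Icc (-a) a ∧ (∀ t, w (-t) = w t) ∧ ∫ t, ‖w t‖ ^ 2 = (1 : ℝ) ∧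
            (weilQuadratic w).re ≤ (weilQuadratic o).re + δ) →
        ∃ u : ℝ → ℂ, (∃ g : ℕ → ℝ → ℂ,
          (∀ n, IsWeilTest (g n) ∧ tsupport (g n) ⊆ Icc (-a) a ∧ ∫ t, ‖g n t‖ ^ 2 = (1 : ℝ)) ∧
          (∀ h : ℝ → ℂ, IsWeilTest h → tsupport h ⊆ Icc (-a) a → ∫ t, ‖h t‖ ^ 2 = (1 : ℝ) →
            ∀ δ : ℝ, 0 < δ → ∀ᶠ n in atTop, (weilQuadratic (g n)).re ≤ (weilQuadratic h).re + δ) ∧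
          Tendsto (fun n ↦ ∫ t, ‖g n t - u t‖ ^ 2) atTop (𝓝 0)) ∧
          (∀ᵐ t : ℝ, t ∈ Ioo (-a) a → (u t).im = 0 ∧ 0 ≤ (u t).re)) := by
  intro A
  refine ⟨max A 1, le_max_left A 1, fun _ ↦ ?_⟩
  have ha : 0 < max A 1 := lt_of_lt_of_le one_pos (le_max_right A 1)
  obtain ⟨g, hg, hmin, hlim⟩ := const_one_passes_all_but_memLp ha
  exact ⟨fun _ ↦ 1, ⟨g, hg, hmin, hlim⟩, Eventually.of_forall fun t _ ↦ ⟨by simp, by simp⟩⟩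

/-! ### 2. The realness clause `Im u = 0` is load-bearing: without it `i·u₀` is a "one-signed ground state" -/

/-- **A genuine ground state with identically vanishing real part.**  At every window `a > 0` at which the even
sector carries the bottom (`ε_ev(a) ≤ ε_od(a)`) the full windowed Weil form has an even ground state `u` with
`Re u ≡ 0`: `u = i·u₀` for the even REAL-VALUED ground state `u₀` of B's `exists_even_real_isWeilGroundState`
(phase invariance, `IsWeilGroundState.const_mul` with `c = i`). [folklore] -/
theorem exists_isWeilGroundState_re_eq_zero {a : ℝ} (ha : 0 < a)
    (hle : weilEvenGroundEnergy a ≤ weilOddGroundEnergy a) :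
    ∃ u : ℝ → ℂ, IsWeilGroundState a u ∧ (∀ t, u (-t) = u t) ∧ ∀ t, (u t).re = 0 := by
  obtain ⟨u₀, hu₀, hev, hre⟩ := exists_even_real_isWeilGroundState ha hle
  refine ⟨fun t ↦ I * u₀ t, hu₀.const_mul (by simp), fun t ↦ by simp only [hev t], fun t ↦ ?_⟩
  simp [Complex.mul_re, hre t]

/-- **… and such a ground state is NOT a.e. real on the window.**  If `Re u ≡ 0` and `Im u = 0` a.e. on `(-a, a)`,
then `u = 0` a.e. on `(-a, a)`, hence a.e. on `ℝ` (a ground state vanishes a.e. off `[-a, a]`,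
`IsWeilGroundState.ae_eq_zero_of_notMem`, and `{±a}` is null) — contradicting `∫‖u‖² = 1`. [folklore] -/
theorem not_ae_real_of_re_eq_zero {a : ℝ} {u : ℝ → ℂ} (hu : IsWeilGroundState a u)
    (hre : ∀ t, (u t).re = 0) :
    ¬ (∀ᵐ t : ℝ, t ∈ Ioo (-a) a → (u t).im = 0) := by
  intro h
  have hend : ∀ᵐ t : ℝ, t ∉ ({-a, a} : Set ℝ) :=
    measure_eq_zero_iff_ae_notMem.1 ((Set.toFinite ({-a, a} : Set ℝ)).measure_zero volume)
  have hz : ∀ᵐ t : ℝ, u t = 0 := by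
    filter_upwards [h, hu.ae_eq_zero_of_notMem, hend] with t h1 h2 h3
    by_cases hI : t ∈ Icc (-a) a
    · have hIoo : t ∈ Ioo (-a) a := by
        simp only [mem_insert_iff, mem_singleton_iff, not_or] at h3
        exact ⟨lt_of_le_of_ne hI.1 (Ne.symm h3.1), lt_of_le_of_ne hI.2 h3.2⟩
      apply Complex.ext
      · simp [hre t]
      · simp [h1 hIoo]
    · exact h2 hI
  have hint0 : ∫ t, ‖u t‖ ^ 2 = (0 : ℝ) := by
    have hae : (fun t ↦ ‖u t‖ ^ 2) =ᵐ[volume] fun _ ↦ (0 : ℝ) :=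
      hz.mono fun t ht ↦ by simp [ht]
    rw [integral_congr_ae hae, integral_zero]
  have h1 := hu.integral_norm_sq
  linarith

/-- **`PolarPerronFrobenius` with the realness clause `Im u = 0` deleted is an RH-free THEOREM**: beyond every
height, at every even-winning window `a ≥ max A 1`, the genuine ground state `u = i·u₀` of
`exists_isWeilGroundState_re_eq_zero` has `0 ≤ Re u` everywhere (MATCHING ⇒ ORDER is B's
`weilEvenGroundEnergy_le_weilOddGroundEnergy_of_evenWinsAt`; the inlined ground-state clause is `IsWeilGroundState`,
B's `isWeilGroundState_iff_forall_eventually_le`).  The clause `0 ≤ Re u` alone carries no sign information.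
Route-inline vocabulary up to the definitional unfoldings `IsWeilTest`/`weilQuadratic`. [folklore] -/
theorem polarPerronFrobenius_trivial_without_real :
    ∀ A : ℝ, ∃ a : ℝ, A ≤ a ∧
      ((∀ o : ℝ → ℂ, IsWeilTest o → tsupport o ⊆ Icc (-a) a → (∀ t, o (-t) = -o t) →
          ∫ t, ‖o t‖ ^ 2 = (1 : ℝ) → ∀ δ : ℝ, 0 < δ → ∃ w : ℝ → ℂ, IsWeilTest w ∧
            tsupport w ⊆ Icc (-a) a ∧ (∀ t, w (-t) = w t) ∧ ∫ t, ‖w t‖ ^ 2 = (1 : ℝ) ∧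
            (weilQuadratic w).re ≤ (weilQuadratic o).re + δ) →
        ∃ u : ℝ → ℂ, (MemLp u 2 ∧ ∃ g : ℕ → ℝ → ℂ,
          (∀ n, IsWeilTest (g n) ∧ tsupport (g n) ⊆ Icc (-a) a ∧ ∫ t, ‖g n t‖ ^ 2 = (1 : ℝ)) ∧
          (∀ h : ℝ → ℂ, IsWeilTest h → tsupport h ⊆ Icc (-a) a → ∫ t, ‖h t‖ ^ 2 = (1 : ℝ) →
            ∀ δ : ℝ, 0 < δ → ∀ᶠ n in atTop, (weilQuadratic (g n)).re ≤ (weilQuadratic h).re + δ) ∧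
          Tendsto (fun n ↦ ∫ t, ‖g n t - u t‖ ^ 2) atTop (𝓝 0)) ∧
          (∀ᵐ t : ℝ, t ∈ Ioo (-a) a → 0 ≤ (u t).re)) := by
  intro A
  refine ⟨max A 1, le_max_left A 1, fun hEW ↦ ?_⟩
  have ha : 0 < max A 1 := lt_of_lt_of_le one_pos (le_max_right A 1)
  obtain ⟨u, hu, -, hre⟩ := exists_isWeilGroundState_re_eq_zero ha
    (weilEvenGroundEnergy_le_weilOddGroundEnergy_of_evenWinsAt ha hEW)
  exact ⟨u, (isWeilGroundState_iff_forall_eventually_le _ u).1 hu,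
    Eventually.of_forall fun t _ ↦ (hre t).ge⟩

/-! ### 3. The sign clause `0 ≤ Re u` is (of course) load-bearing too — census complete -/

/-- **`PolarPerronFrobenius` with the sign clause `0 ≤ Re u` deleted is an RH-free theorem** (B's even real-valued
ground state `exists_even_real_isWeilGroundState` itself, in crux shape).  With items 1 and 2: each of the clauses
`MemLp u 2`, `Im u = 0`, `0 ≤ Re u` of the conclusion is individually load-bearing, and the content of the crux is
exactly "a genuine `L²` ground state with values in `[0, ∞)` a.e. on the open window". [folklore] -/
theorem polarPerronFrobenius_trivial_without_sign :
    ∀ A : ℝ, ∃ a : ℝ, A ≤ a ∧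
      ((∀ o : ℝ → ℂ, IsWeilTest o → tsupport o ⊆ Icc (-a) a → (∀ t, o (-t) = -o t) →
          ∫ t, ‖o t‖ ^ 2 = (1 : ℝ) → ∀ δ : ℝ, 0 < δ → ∃ w : ℝ → ℂ, IsWeilTest w ∧
            tsupport w ⊆ Icc (-a) a ∧ (∀ t, w (-t) = w t) ∧ ∫ t, ‖w t‖ ^ 2 = (1 : ℝ) ∧
            (weilQuadratic w).re ≤ (weilQuadratic o).re + δ) →
        ∃ u : ℝ → ℂ, (MemLp u 2 ∧ ∃ g : ℕ → ℝ → ℂ,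
          (∀ n, IsWeilTest (g n) ∧ tsupport (g n) ⊆ Icc (-a) a ∧ ∫ t, ‖g n t‖ ^ 2 = (1 : ℝ)) ∧
          (∀ h : ℝ → ℂ, IsWeilTest h → tsupport h ⊆ Icc (-a) a → ∫ t, ‖h t‖ ^ 2 = (1 : ℝ) →
            ∀ δ : ℝ, 0 < δ → ∀ᶠ n in atTop, (weilQuadratic (g n)).re ≤ (weilQuadratic h).re + δ) ∧
          Tendsto (fun n ↦ ∫ t, ‖g n t - u t‖ ^ 2) atTop (𝓝 0)) ∧
          (∀ᵐ t : ℝ, t ∈ Ioo (-a) a → (u t).im = 0)) := by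
  intro A
  refine ⟨max A 1, le_max_left A 1, fun hEW ↦ ?_⟩
  have ha : 0 < max A 1 := lt_of_lt_of_le one_pos (le_max_right A 1)
  obtain ⟨u, hu, -, hre⟩ := exists_even_real_isWeilGroundState ha
    (weilEvenGroundEnergy_le_weilOddGroundEnergy_of_evenWinsAt ha hEW)
  exact ⟨u, (isWeilGroundState_iff_forall_eventually_le _ u).1 hu,
    Eventually.of_forall fun t _ ↦ hre t⟩

end Summit.RiemannHypothesis.RiemannHypothesis.Theorems.PolarPerronFrobenius.Negative

end
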